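import Summits.BirchSwinnertonDyer.Rank1Residual.Additive.WildThreeDivisibilitySuffices
import Summits.BirchSwinnertonDyer.Rank1Residual.Additive.PotSupersingularClasses
import Summits.BirchSwinnertonDyer.Rank1Residual.X11b.RingClassFieldNoTorsion
import Summits.BirchSwinnertonDyer.Rank1Residual.X11b.KolyvaginBottomPoint
import Literature.NumberTheory.EllipticCurves.HeegnerPointsOfConductorOneData
import Literature.NumberTheory.EllipticCurves.HeegnerPointsOfConductorOneRationalityProofs
import Literature.NumberTheory.EllipticCurves.HeegnerPointsOfConductorOneGaloisConjProofs
import Literature.NumberTheory.EllipticCurves.HeegnerPointsKolyvaginPrimaryClassesProofs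
import Literature.NumberTheory.EllipticCurves.HeegnerPointsKolyvaginPrimaryGeneratorProofs
import Literature.NumberTheory.EllipticCurves.KummerMap
import Literature.NumberTheory.EllipticCurves.MordellWeilTheoremProofs
import Literature.NumberTheory.EllipticCurves.BSDRankZeroDensity
import HarnessLib

/-!
# Route `SemiOrdinaryEisensteinDescent`, crux Ko `WildKolyvaginUpperAtThree` (stmt-BirchSwinnertonDyer-20480), line
# `birth`: registered stub `stub_minftyFinite` — `M_∞` IS FINITE on the crux's frame
# (lead prover `bsd-wall-soed-p2` g0; `--supports stmt-BirchSwinnertonDyer-20480`; BSD is not proved by any of this)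

WHAT IS PROVED (sorry-free, no named fact taken as a hypothesis). On the binders of the crux (`W/ℚ` globally minimal
elliptic, wild potentially supersingular at `3`, `ρ̄_{E,3}` onto, `r_an = 1`, `3`-adic tower, `K` imaginary quadratic
Heegner for `N_E`, `d_K` odd, `d_K ≠ −3`, `L(E^{d_K},1) ≠ 0`, a frame `(Dt, H, ι)` and `P ∈ E(K)` with
`ι(P) = heegnerPointComplex Dt H` of infinite order) the divisibility index of the Heegner-point Kolyvagin system at
`p = 3` is FINITE: `∃ m, AdditiveThree.MinftyEq W K Dt H.β ι m` (`M_∞ = m`: every class `3^m`-divisible, some class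
not `3^{m+1}`-divisible). Only `ρ̄_{E,3}` onto, `K` imaginary quadratic Heegner and `P` non-torsion are used; the
other binders are carried verbatim because the stub is registered with them.

MECHANISM (McCallum 1991 Lemma 5.1 / Cor. 4.5 at `n = 1`, every step a tree theorem):
* `E(K)` is finitely generated (`module_finite_point_holds`, Mordell–Weil) and `P` is non-torsion, so `3^{M₀} ∥ P`
  in `E(K)` for some `M₀` (`exists_pow_smul_eq_and_forall_ne`);
* the conductor-`1` Kolyvagin–Heegner datum `d₁` on `(Dt, H.β, ι)` exists (`exists_kolyvaginHeegnerData_one` over the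
  DISCHARGED Darmon Thm. 3.6 `phi_heegnerTau_mem_singularModuliField_holds`), and its derived point `P(1) = Tr y(1)`
  is the image of `P` (`heegnerSystem_exists_isHeegnerPoint_map_eq_derivedPoint_one` +
  `KolyvaginBottom.eq_of_map_eq_heegnerPointComplex` over the DISCHARGED Shimura reciprocity at conductor `1`,
  `heegnerPointOfConductor_one_galoisConj_holds`);
* `E(K[1]) ⊆ E(K̄)` is admissible for `3^M` (`RingClassNoTorsion.isAdmissible_pointsSubgroup_three`: `Γ_K`-stable, no
  `3`-power torsion — Gross Lemma 4.3 from `ρ̄_{E,3}` onto) and `P(1)` is `Γ_K`-fixed, so `c_M(1)` is McCallum's GENUINE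
  class, which for a point coming from `E(K)` is the Kummer class `δ(P)` (`kolyvaginClass_toGeomPoints`, Gross (4.4)
  `c(1) = δ y_K`); the Kummer map has kernel `3^M E(K)` (`kummerMapTorsion_ker`), so `c_{M₀+1}(1) ≠ 0`;
* `H¹(K, E[3^M])` is killed by `3^M` (`zsmul_galH1Torsion_eq_zero`), so a `3^M`-divisible class of level `M` is `0`:
  `c_{M₀+1}(1)` is not `3^{M₀+1}`-divisible, i.e. `¬ MinftyGe … (M₀+1)`, and
  `AdditiveThree.exists_minftyEq_of_not_minftyGe` gives `M_∞ = m` for some `m ≤ M₀`.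

References: [McCallumLMS1991] §4 (5), Cor. 4.5, §5 Lemma 5.1 (p. 303); [GrossLMS1991] §4 Lemma 4.3, (4.1) and the
remark `P_1 = y_K`; [WZhang2014] §3.8 (`M_∞`).
-/

set_option autoImplicit false
set_option linter.dupNamespace false -- `Summit.BirchSwinnertonDyer.BirchSwinnertonDyer.…` is the tree's layout (D-0017)

noncomputable section

open scoped Classical

namespace Summit.BirchSwinnertonDyer.BirchSwinnertonDyer.Theorems.WildKolyvaginUpperAtThree

open WeierstrassCurve NumberField Field Literature.NumberTheory.EllipticCurves
  Literature.NumberTheory.EllipticCurves.ModularForms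
  Literature.NumberTheory.EllipticCurves.KolyvaginCocycle
  Summit.BirchSwinnertonDyer.Rank1Residual
  Summit.BirchSwinnertonDyer.Rank1Residual.Additive
  Summit.BirchSwinnertonDyer.Rank1Residual.X11b

/-- **A NON-ZERO class of level `3^M` refutes `M_∞ ≥ M`** (class currency): if some Kolyvagin class `c_M(n) ≠ 0` at a
square-free product `n` of Kolyvagin primes with `1 ≤ M ≤ M(n)`, then `¬ MinftyGe W K Dt β ι M` — a `3^M`-divisible
element of the `3^M`-torsion group `H¹(K, E[3^M])` is `0` (`zsmul_galH1Torsion_eq_zero`). [folklore] -/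
theorem not_minftyGe_of_kolyvaginClass_ne_zero
    (W : WeierstrassCurve ℚ) [W.IsGloballyMinimal] (K : Type) [Field K] [NumberField K]
    [NeZero (W.conductorNorm ℤ)] (Dt : ModularParametrizationData W (W.conductorNorm ℤ)) (β : ℤ) (ι : K →+* ℂ)
    {n : ℕ} (d : KolyvaginHeegnerData Dt β ι n) {M : ℕ}
    (hn : KolyvaginDescent.KolSupp (Zhang2014.IsKolyvaginPrime (W.conductorNorm ℤ) W K 3) n)
    (h1 : 1 ≤ M) (hM : (M : ℕ∞) ≤ Zhang2014.levelIndex W 3 n)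
    (hne : d.kolyvaginClass Nat.prime_three M ≠ 0) :
    ¬ AdditiveThree.MinftyGe W K Dt β ι M := by
  intro h
  obtain ⟨x, hx⟩ := h n d M hn h1 hM
  apply hne
  rw [hx, ← natCast_zsmul]
  exact zsmul_galH1Torsion_eq_zero (W.baseChange K) _ x

/-- **`3^M ∤ P` in `E(K)` ⟹ the conductor-`1` class `c_M(1)` is non-zero** (Gross 1991 (4.4) `c(1) = δ y_K` with
the injectivity of the Kummer map on `E(K)/3^M E(K)`; McCallum 1991 Lemma 5.1 / Cor. 4.5 at `n = 1`, `p = 3`): for `K`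
imaginary quadratic Heegner for `N_E`, `ρ̄_{E,3}` onto, a conductor-`1` datum `d₁` on the frame `(Dt, H.β, ι)` of a point
`P ∈ E(K)` with `ι(P) = heegnerPointComplex Dt H`, and `M` with no `Q ∈ E(K)`, `3^M Q = P`:
`d₁.kolyvaginClass _ M ≠ 0`. Shimura reciprocity at conductor `1` (`P(1) ↦ P`) enters through its DISCHARGED tree
theorem `heegnerPointOfConductor_one_galoisConj_holds`. [cite: GrossLMS1991, §4 (4.4) and Lemma 4.3]
[cite: McCallumLMS1991, §4 Cor. 4.5 and §5 Lemma 5.1 (p. 303)] -/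
theorem kolyvaginClass_one_ne_zero_of_not_divisible
    (W : WeierstrassCurve ℚ) [W.IsElliptic] [W.IsGloballyMinimal] (K : Type) [Field K] [NumberField K]
    [NeZero (W.conductorNorm ℤ)] (hsurj : W.HasSurjectiveModNGaloisRep 3) (hK : IsImaginaryQuadratic K)
    (hHH : SatisfiesHeegnerHypothesis (W.conductorNorm ℤ) K)
    (Dt : ModularParametrizationData W (W.conductorNorm ℤ))
    (H : HeegnerDatum (W.conductorNorm ℤ) (NumberField.discr K)) (ι : K →+* ℂ)
    (P : (W.baseChange K).toAffine.Point)
    (hP : WeierstrassCurve.Affine.Point.map ι.toRatAlgHom P = heegnerPointComplex Dt H)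
    (d₁ : KolyvaginHeegnerData Dt H.β ι 1) {M : ℕ}
    (hndiv : ¬ ∃ Q : (W.baseChange K).toAffine.Point, ((3 ^ M : ℕ) : ℤ) • Q = P) :
    d₁.kolyvaginClass Nat.prime_three M ≠ 0 := by
  haveI : Fact (Nat.Prime 3) := ⟨Nat.prime_three⟩
  -- `P(1) ∈ E(K̄)` is the image of `P` (Shimura reciprocity at conductor `1`, discharged in the tree)
  have hgeom : d₁.toGeomPoints d₁.derivedPoint = toGeomPoints (W.baseChange K) P :=
    KolyvaginBottom.toGeomPoints_derivedPoint_one_eq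
      (heegnerPointOfConductor_one_galoisConj_holds (W.conductorNorm ℤ) W K) hK hHH hP d₁ rfl
  -- the standing inputs of McCallum's cocycle: admissibility (Gross Lemma 4.3) and invariance (`P(1)` is `Γ_K`-fixed)
  have hA := RingClassNoTorsion.isAdmissible_pointsSubgroup_three d₁ hK one_ne_zero hsurj M
  have hinv : d₁.toGeomPoints d₁.derivedPoint ∈
      invPoints (absoluteGaloisGroup K) d₁.pointsSubgroup ((3 ^ M : ℕ) : ℤ) := by
    refine mem_invPoints_of_fixed ⟨d₁.derivedPoint, rfl⟩ fun g ↦ ?_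
    rw [hgeom, smul_toGeomPoints]
  rw [d₁.kolyvaginClass_of_admissible Nat.prime_three M hA hinv]
  -- the genuine class of a point of `E(K)` is its Kummer class, whose vanishing means `P ∈ 3^M E(K)`
  suffices key : ∀ (hdiv : ∀ R : geomPoints (W.baseChange K), ∃ Q : geomPoints (W.baseChange K),
        ((3 ^ M : ℕ) : ℤ) • Q = R)
      (Q : geomPoints (W.baseChange K))
      (hQ : Q ∈ invPoints (absoluteGaloisGroup K) d₁.pointsSubgroup ((3 ^ M : ℕ) : ℤ)),
      Q = toGeomPoints (W.baseChange K) P →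
        Literature.NumberTheory.EllipticCurves.kolyvaginClass (W.baseChange K) ((3 ^ M : ℕ) : ℤ) hdiv hA Q hQ ≠ 0 from
    key _ _ hinv hgeom
  rintro hdiv Q hQ rfl h0
  rw [kolyvaginClass_toGeomPoints hA P hQ] at h0
  have hmem : P ∈ (kummerMapTorsion (W.baseChange K) ((3 ^ M : ℕ) : ℤ) hdiv).ker :=
    (AddMonoidHom.mem_ker).mpr h0
  rw [kummerMapTorsion_ker] at hmem
  obtain ⟨R, hR⟩ := hmem
  exact hndiv ⟨R, hR⟩

/-- **Registered stub `stub_minftyFinite` of line `birth` (crux Ko `WildKolyvaginUpperAtThree`), PROVED:** on the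
crux's binders, `∃ m, AdditiveThree.MinftyEq W K Dt H.β ι m` — the divisibility index `M_∞` of the Heegner-point
Kolyvagin system at `p = 3` on the frame `(Dt, H.β, ι)` is finite. Proof: `3^{M₀} ∥ P` in the finitely generated
`E(K)` (`P` non-torsion); the conductor-`1` datum exists and its class `c_{M₀+1}(1)` is non-zero
(`kolyvaginClass_one_ne_zero_of_not_divisible`); so `¬ M_∞ ≥ M₀ + 1` (`not_minftyGe_of_kolyvaginClass_ne_zero`) and
`AdditiveThree.exists_minftyEq_of_not_minftyGe` concludes. Unconditional (the conductor-`1` inputs are discharged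
tree theorems); the binders `ClassO6`, `r_an = 1`, tower, `d_K` odd / `≠ −3`, `L(E^{d_K},1) ≠ 0` are idle.
[cite: McCallumLMS1991, §5 Lemma 5.1 (p. 303) and §4 Cor. 4.5] [cite: WZhang2014, §3.8 (M_∞)] -/
theorem stub_minftyFinite :
    ∀ (W : WeierstrassCurve ℚ) [W.IsElliptic] [W.IsGloballyMinimal],
      Summit.BirchSwinnertonDyer.Rank1Residual.Additive.ClassO6 W 3 → W.HasSurjectiveModNGaloisRep 3 →
      W.analyticRank = 1 → Summit.BirchSwinnertonDyer.Rank1Residual.AdditiveThree.TowerSurjThree W →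
      ∀ (K : Type) [Field K] [NumberField K], Literature.NumberTheory.EllipticCurves.IsImaginaryQuadratic K →
      Odd (NumberField.discr K) → NumberField.discr K ≠ -3 → ∀ [NeZero (W.conductorNorm ℤ)],
      Literature.NumberTheory.EllipticCurves.SatisfiesHeegnerHypothesis (W.conductorNorm ℤ) K →
      (W.quadraticTwist (NumberField.discr K : ℚ)).entireLFunction 1 ≠ 0 →
      ∀ (Dt : Literature.NumberTheory.EllipticCurves.ModularForms.ModularParametrizationData W (W.conductorNorm ℤ))
        (H : Literature.NumberTheory.EllipticCurves.HeegnerDatum (W.conductorNorm ℤ) (NumberField.discr K))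
        (ι : K →+* ℂ) (P : (W.baseChange K).toAffine.Point),
      (WeierstrassCurve.Affine.Point.map ι.toRatAlgHom) P =
        Literature.NumberTheory.EllipticCurves.ModularForms.heegnerPointComplex Dt H →
      ¬ IsOfFinAddOrder P →
      ∃ m : ℕ, Summit.BirchSwinnertonDyer.Rank1Residual.AdditiveThree.MinftyEq W K Dt H.β ι m := by
  intro W _ _ _hO6 hsurj _hr _htower K _ _ hK _hodd _h3 _ hHH _hLd Dt H ι P hP hnt
  -- `3^{M₀} ∥ P` in the finitely generated group `E(K)`
  haveI : Module.Finite ℤ (W.baseChange K).toAffine.Point := (W.baseChange K).module_finite_point_holds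
  obtain ⟨M₀, x₀, -, hmax⟩ := exists_pow_smul_eq_and_forall_ne hnt (p := 3) (by norm_num)
  have hndiv : ¬ ∃ Q : (W.baseChange K).toAffine.Point, ((3 ^ (M₀ + 1) : ℕ) : ℤ) • Q = P := by
    rintro ⟨Q, hQ⟩
    exact hmax Q (by rw [← natCast_zsmul]; exact hQ)
  -- the conductor-`1` datum and its non-zero class of level `3^{M₀+1}`
  obtain ⟨d₁⟩ := exists_kolyvaginHeegnerData_one
    (phi_heegnerTau_mem_singularModuliField_holds (W.conductorNorm ℤ) W K) hK Dt H.β ι H.dvd_sq_sub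
  have hne := kolyvaginClass_one_ne_zero_of_not_divisible W K hsurj hK hHH Dt H ι P hP d₁ hndiv
  -- `¬ M_∞ ≥ M₀ + 1`, hence `M_∞ = m` for some `m`
  exact AdditiveThree.exists_minftyEq_of_not_minftyGe W K Dt H.β ι
    (not_minftyGe_of_kolyvaginClass_ne_zero W K Dt H.β ι d₁ (KolyvaginDescent.kolSupp_one _) (by omega)
      (by rw [Zhang2014.levelIndex_one]; exact le_top) hne)

end Summit.BirchSwinnertonDyer.BirchSwinnertonDyer.Theorems.WildKolyvaginUpperAtThree

end
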